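import Summits.BirchSwinnertonDyer.BirchSwinnertonDyer.Theorems.ByReductionTypeAtTwoSupersingularTowerTorsionTwo
import Summits.BirchSwinnertonDyer.Rank1Residual.Additive.PadicClosureCyclotomicGalois
import Literature.NumberTheory.EllipticCurves.TateModuleBaseChange
import Literature.NumberTheory.EllipticCurves.SelmerCorankProofs
import Literature.NumberTheory.EllipticCurves.GaloisActionProofs
import HarnessLib

/-!
# Residual rigidity at `2`, tools: `E(ℚ̄₂)[2]` at a good supersingular `2` — no `ℚ₂`-rational point of order `2`, the three
# points of order `2`, and `√Δ ∉ ℚ₂` — for the crux `SignedTransportAtTwo` (stmt-BirchSwinnertonDyer-20333, route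
# `ThetaPartnerAtTwo`, line `bridge` v16, stub `stub_sel2Tb` step T5) (lead prover bsd-wall-tp2-p1 g5;
# `--supports stmt-BirchSwinnertonDyer-20333`; route-independent, closes nothing)

HONEST FRAMING. THEOREMS ONLY (no definition); nothing about any Selmer group is asserted; BSD is not proved by any of this.
No import of any route file.

WHY. The local transport stub `stub_sel2Tb` asks for a `Gal(ℚ̄₂/ℚ₂)`-equivariant homomorphism `Ψ : W(ℚ̄₂) → A(ℚ̄₂)`
RESTRICTING TO A GIVEN equivariant `ẽ : W[2] ≃ A[2]`. The Honda construction produces some equivariant `Ψ`; that its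
restriction to `W[2]` is `ẽ` is the statement that equivariant isomorphisms `W[2] ≃ A[2]` are UNIQUE, i.e. that the image
of `Gal(ℚ̄₂/ℚ₂)` in `Aut E[2] ≅ S₃` has trivial centraliser (it is all of `S₃`: `ℚ₂(E[2]) = ℚ₂(∛2, ζ₃)` for the Honda type
`X² + 2`). This file supplies the two arithmetic inputs, for `W/ℚ` globally minimal with good supersingular reduction at `2`:

* §1 (i) `eq_zero_of_forall_smul_eq_of_two_nsmul_padic`: a `Gal(ℚ̄₂/ℚ₂)`-fixed `2`-torsion point of `E(ℚ̄₂)` is `O`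
  (Galois descent to `E(ℚ₂)` and `E(ℚ₂)[2] = 0`, tree `SSFlatEC.two_nsmul_eq_zero_padic_of_goodSS_two`).
* §2 the coordinates of the points of order `2`: the action is coordinatewise, a point of order `2` is determined by its
  `x`-coordinate, which is a root of `4x³ + b₂x² + 2b₄x + b₆`; `E(ℚ̄₂)[2] = {O, P₁, P₂, P₃}` (`#E[2] = 4`,
  `card_torsionPoints_eq_sq_holds`); `Δ_min = 16·((x₁−x₂)(x₁−x₃)(x₂−x₃))²` (`Cubic.discr_eq_prod_three_roots`,
  `twoTorsionPolynomial_discr`); a `Gal(ℚ̄₂/ℚ₂)`-fixed element of `ℚ̄₂` lies in `ℚ₂`; and `Δ_min ≠ 16d₀²` for `d₀ ∈ ℚ₂`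
  (`Δ_min ≡ 5 (mod 8)`, tree `minimalDiscriminantInt_emod_eight_eq_five_of_goodSS_two`; squares are `0, 1, 4 mod 8`).

The sibling file `…ResidualRigidity.lean` assembles these into the rigidity statement.

References: [Serre1972] §5.3 (image of inertia at a supersingular prime); [SilvermanAEC2009] III.2.3, III.6.4, VIII.§1;
[Serre1973] Ch. II §3.3 (squares in `ℚ₂`); [BDKim2009] Prop. 2.11–2.12 (p. 186); [Kobayashi2003] §8.
-/

set_option autoImplicit false
-- D-0017: single-problem summit, so `Summit.BirchSwinnertonDyer.BirchSwinnertonDyer.…` repeats a namespace BY DESIGN.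
set_option linter.dupNamespace false

noncomputable section

open scoped Classical AddSubgroup

open WeierstrassCurve Literature.NumberTheory.EllipticCurves Literature.NumberTheory.GaloisRepresentations
  Literature.NumberTheory.EllipticCurves.Rank1Residual Field

namespace Summit.BirchSwinnertonDyer.BirchSwinnertonDyer.Theorems.SignedTransportAtTwo

universe u

/-! ## §1 (i): no non-zero `Gal(ℚ̄₂/ℚ₂)`-fixed `2`-torsion point at a good supersingular `2` -/

section NoFixed

variable (W : WeierstrassCurve ℚ) [W.IsElliptic] [W.IsGloballyMinimal]

omit [W.IsElliptic] in
/-- **`E(ℚ̄₂)[2]^{Gal(ℚ̄₂/ℚ₂)} = 0` at a good supersingular `2`.** A `2`-torsion point of `E(ℚ̄₂)` fixed by `Gal(ℚ̄₂/ℚ₂)`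
is `ℚ₂`-rational (Galois descent, `ℚ₂` perfect), and `E(ℚ₂)[2] = 0` (`SSFlatEC.two_nsmul_eq_zero_padic_of_goodSS_two`:
a `2`-adic root of `4x³ + b₂x² + 2b₄x + b₆` is impossible for `4 ∣ b₂`, `2 ∣ b₄`, `b₆` odd).
[cite: SilvermanAEC2009, VIII.§1 and III.2.3] -/
theorem eq_zero_of_forall_smul_eq_of_two_nsmul_padic (hss : GoodSS W 2) {P : localPoints W ℚ_[2]}
    (hfix : ∀ σ : absoluteGaloisGroup ℚ_[2], σ • P = P) (h2 : (2 : ℕ) • P = 0) : P = 0 := by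
  haveI : CharZero ℚ_[2] := inferInstance
  set Q : geomPoints (W.baseChange ℚ_[2]) := localPointsEquivBaseChange W ℚ_[2] P with hQdef
  have hQ : ∀ σ : absoluteGaloisGroup ℚ_[2], σ • Q = Q := fun σ ↦ by
    rw [hQdef, ← localPointsEquivBaseChange_smul W ℚ_[2] σ P, hfix σ]
  obtain ⟨P₀, hP₀⟩ := WeierstrassCurve.exists_toGeomPoints_eq_of_forall_smul_eq (W.baseChange ℚ_[2]) hQ
  have hP₀2 : (2 : ℕ) • P₀ = 0 := by
    apply WeierstrassCurve.toGeomPoints_injective (W.baseChange ℚ_[2])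
    rw [map_nsmul, hP₀, map_zero, hQdef, ← map_nsmul, h2, map_zero]
  have hP₀0 : P₀ = 0 := SSFlatEC.two_nsmul_eq_zero_padic_of_goodSS_two W hss P₀ hP₀2
  have hQ0 : Q = 0 := by rw [← hP₀, hP₀0, map_zero]
  exact (localPointsEquivBaseChange W ℚ_[2]).injective (by rw [← hQdef, hQ0, map_zero])

end NoFixed

/-! ## §2 The points of order `2`: coordinates, count, `√Δ` -/

section Mixed

open Summit.BirchSwinnertonDyer.Rank1Residual

variable (W : WeierstrassCurve ℚ) [W.IsElliptic] [W.IsGloballyMinimal]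

omit [W.IsElliptic] [W.IsGloballyMinimal] in
/-- **The Galois action on `E(ℚ̄₂)` is coordinatewise.** [cite: SilvermanAEC2009, VIII.§1] -/
theorem smul_eq_some (σ : absoluteGaloisGroup ℚ_[2]) {P : localPoints W ℚ_[2]} {x y : (AlgebraicClosure ℚ_[2])}
    {h : (W.baseChange (AlgebraicClosure ℚ_[2])).toAffine.Nonsingular x y} (hP : P = Affine.Point.some x y h) :
    ∃ h', σ • P = Affine.Point.some (σ • x) (σ • y) h' := by
  subst hP
  refine ⟨(Affine.baseChange_nonsingular (W := W.toAffine)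
    (f := ((AlgEquiv.restrictScalars ℚ (show (AlgebraicClosure ℚ_[2]) ≃ₐ[ℚ_[2]] (AlgebraicClosure ℚ_[2]) from σ) : (AlgebraicClosure ℚ_[2]) ≃ₐ[ℚ] (AlgebraicClosure ℚ_[2])) : (AlgebraicClosure ℚ_[2]) →ₐ[ℚ] (AlgebraicClosure ℚ_[2])))
    (AlgEquiv.injective _) x y).mpr h, ?_⟩
  rw [localPoints.smul_def]
  change Affine.Point.map _ (Affine.Point.some x y h) = _
  rw [Affine.Point.map_some]
  rfl

omit [W.IsElliptic] [W.IsGloballyMinimal] in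
/-- A non-zero local point is an affine point. [folklore] -/
theorem exists_eq_some_of_ne_zero {P : localPoints W ℚ_[2]} (hP : P ≠ 0) :
    ∃ (x y : (AlgebraicClosure ℚ_[2])) (h : (W.baseChange (AlgebraicClosure ℚ_[2])).toAffine.Nonsingular x y), P = Affine.Point.some x y h := by
  rcases P with _ | ⟨x, y, h⟩
  · exact absurd rfl hP
  · exact ⟨x, y, h, rfl⟩

omit [W.IsElliptic] [W.IsGloballyMinimal] in
/-- Reading off the `x`-coordinate. [folklore] -/
theorem x_eq_of_eq_some {P : localPoints W ℚ_[2]} {x y x' y' : (AlgebraicClosure ℚ_[2])} {h : (W.baseChange (AlgebraicClosure ℚ_[2])).toAffine.Nonsingular x y}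
    {h' : (W.baseChange (AlgebraicClosure ℚ_[2])).toAffine.Nonsingular x' y'} (hP : P = Affine.Point.some x y h)
    (hP' : P = Affine.Point.some x' y' h') : x = x' := by
  subst hP
  have hh : (Affine.Point.some x y h : (W.baseChange (AlgebraicClosure ℚ_[2])).toAffine.Point) = Affine.Point.some x' y' h' := hP'
  rw [Affine.Point.some.injEq] at hh
  exact hh.1

omit [W.IsElliptic] [W.IsGloballyMinimal] in
/-- Two NON-ZERO points of order dividing `2` with the same `x`-coordinate are equal (for such a point
`y = −y − a₁x − a₃` is determined by `x`). [cite: SilvermanAEC2009, III.2.3] -/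
theorem eq_of_x_eq {P Q : localPoints W ℚ_[2]} {x y y' : (AlgebraicClosure ℚ_[2])} {h : (W.baseChange (AlgebraicClosure ℚ_[2])).toAffine.Nonsingular x y}
    {h' : (W.baseChange (AlgebraicClosure ℚ_[2])).toAffine.Nonsingular x y'} (hP : P = Affine.Point.some x y h)
    (hQ : Q = Affine.Point.some x y' h') (h2 : (2 : ℕ) • P = 0) : P = Q := by
  subst hP hQ
  have hneg : y = (W.baseChange (AlgebraicClosure ℚ_[2])).toAffine.negY x y := by
    have h2' : (2 : ℕ) • (Affine.Point.some x y h : (W.baseChange (AlgebraicClosure ℚ_[2])).toAffine.Point) = 0 := h2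
    rw [two_nsmul, add_eq_zero_iff_eq_neg, Affine.Point.neg_some, Affine.Point.some.injEq] at h2'
    exact h2'.2
  have hy : y' = y := by
    rcases Affine.Y_eq_of_X_eq h'.1 h.1 rfl with e | e
    · exact e
    · rw [e, ← hneg]
  subst hy
  rfl

omit [W.IsElliptic] [W.IsGloballyMinimal] in
/-- The `x`-coordinate of a point of order dividing `2` is a root of the `2`-division cubic `4x³ + b₂x² + 2b₄x + b₆`
(Mathlib's `twoTorsionPolynomial`). [cite: SilvermanAEC2009, III.2.3] -/
theorem isRoot_twoTorsionPolynomial_of_eq_some {P : localPoints W ℚ_[2]} {x y : (AlgebraicClosure ℚ_[2])}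
    {h : (W.baseChange (AlgebraicClosure ℚ_[2])).toAffine.Nonsingular x y} (hP : P = Affine.Point.some x y h) (h2 : (2 : ℕ) • P = 0) :
    (W.baseChange (AlgebraicClosure ℚ_[2])).twoTorsionPolynomial.toPoly.IsRoot x := by
  subst hP
  have hc := SSFlatEC.fourCubic_eq_zero_of_two_nsmul_eq_zero_field (W.baseChange (AlgebraicClosure ℚ_[2])) (x := x) (y := y) (h := h) h2
  rw [Polynomial.IsRoot, Cubic.toPoly, WeierstrassCurve.twoTorsionPolynomial]
  simp only [Polynomial.eval_add, Polynomial.eval_mul, Polynomial.eval_C, Polynomial.eval_pow, Polynomial.eval_X]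
  linear_combination hc

omit [W.IsGloballyMinimal] in
/-- **Three points of order `2`.** `E(ℚ̄₂)[2]` has order `4` (`card_torsionPoints_eq_sq_holds`), so it consists of `O` and
three distinct points `P₁, P₂, P₃ = P₁ + P₂`. [cite: SilvermanAEC2009, Cor. III.6.4(b)] -/
theorem exists_three_two_torsion :
    ∃ P₁ P₂ P₃ : localPoints W ℚ_[2], (2 : ℕ) • P₁ = 0 ∧ (2 : ℕ) • P₂ = 0 ∧ (2 : ℕ) • P₃ = 0 ∧
      P₁ ≠ 0 ∧ P₂ ≠ 0 ∧ P₃ ≠ 0 ∧ P₁ ≠ P₂ ∧ P₁ ≠ P₃ ∧ P₂ ≠ P₃ ∧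
      ∀ Q : localPoints W ℚ_[2], (2 : ℕ) • Q = 0 → Q = 0 ∨ Q = P₁ ∨ Q = P₂ ∨ Q = P₃ := by
  have h2ne : ((2 : ℕ) : (AlgebraicClosure ℚ_[2])) ≠ 0 := by norm_num
  have hcard : Nat.card ((localPoints W ℚ_[2])[(2 : ℕ)]) = 2 ^ 2 :=
    WeierstrassCurve.card_torsionPoints_eq_sq_holds W (AlgebraicClosure ℚ_[2]) (n := 2) h2ne
  haveI hfin : Finite ↥((localPoints W ℚ_[2])[(2 : ℕ)]) := Nat.finite_of_card_ne_zero (by rw [hcard]; norm_num)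
  haveI : Fintype ↥((localPoints W ℚ_[2])[(2 : ℕ)]) := Fintype.ofFinite _
  -- three distinct elements of the `2`-torsion; two of them are non-zero and distinct
  have h3 : 2 < Fintype.card ↥((localPoints W ℚ_[2])[(2 : ℕ)]) := by
    rw [← Nat.card_eq_fintype_card, hcard]; norm_num
  obtain ⟨a, b, c, hab, hac, hbc⟩ := Fintype.two_lt_card_iff.mp h3
  -- pick two distinct non-zero ones
  obtain ⟨u, w, hu0, hw0, huw⟩ : ∃ u w : ↥((localPoints W ℚ_[2])[(2 : ℕ)]), u ≠ 0 ∧ w ≠ 0 ∧ u ≠ w := by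
    by_cases ha : a = 0
    · exact ⟨b, c, fun h ↦ hab (ha.trans h.symm), fun h ↦ hac (ha.trans h.symm), hbc⟩
    · by_cases hb : b = 0
      · exact ⟨a, c, ha, fun h ↦ hbc (hb.trans h.symm), hac⟩
      · exact ⟨a, b, ha, hb, hab⟩
  have hmem : ∀ {Q : localPoints W ℚ_[2]}, Q ∈ (localPoints W ℚ_[2])[(2 : ℕ)] ↔ (2 : ℕ) • Q = 0 :=
    fun {Q} ↦ AddSubgroup.torsionBy.nsmul_iff
  have hu2 : (2 : ℕ) • (u : localPoints W ℚ_[2]) = 0 := hmem.mp u.2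
  have hw2 : (2 : ℕ) • (w : localPoints W ℚ_[2]) = 0 := hmem.mp w.2
  have huw2 : (2 : ℕ) • ((u : localPoints W ℚ_[2]) + w) = 0 := by rw [smul_add, hu2, hw2, add_zero]
  have hu0' : (u : localPoints W ℚ_[2]) ≠ 0 := fun h ↦ hu0 (Subtype.ext h)
  have hw0' : (w : localPoints W ℚ_[2]) ≠ 0 := fun h ↦ hw0 (Subtype.ext h)
  have huw' : (u : localPoints W ℚ_[2]) ≠ w := fun h ↦ huw (Subtype.ext h)
  -- `-w = w` for a `2`-torsion point
  have hnegw : -(w : localPoints W ℚ_[2]) = w := by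
    rw [neg_eq_iff_add_eq_zero, ← two_nsmul]; exact hw2
  have hs0 : (u : localPoints W ℚ_[2]) + w ≠ 0 := fun h ↦ by
    rw [add_eq_zero_iff_eq_neg, hnegw] at h; exact huw' h
  have hsu : (u : localPoints W ℚ_[2]) + w ≠ u := fun h ↦ hw0' (by simpa using h)
  have hsw : (u : localPoints W ℚ_[2]) + w ≠ w := fun h ↦ hu0' (by simpa using h)
  refine ⟨u, w, u + w, hu2, hw2, huw2, hu0', hw0', hs0, huw', hsu.symm, hsw.symm, fun Q hQ ↦ ?_⟩
  -- exhaustion by counting: a fifth element of `E[2]` would contradict `#E[2] = 4`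
  by_contra hne
  push Not at hne
  obtain ⟨hQ0, hQu, hQw, hQs⟩ := hne
  set s : ↥((localPoints W ℚ_[2])[(2 : ℕ)]) := ⟨(u : localPoints W ℚ_[2]) + w, hmem.mpr huw2⟩ with hs
  set q : ↥((localPoints W ℚ_[2])[(2 : ℕ)]) := ⟨Q, hmem.mpr hQ⟩ with hq
  have ne1 : (0 : ↥((localPoints W ℚ_[2])[(2 : ℕ)])) ≠ u := fun h ↦ hu0 h.symm
  have ne2 : (0 : ↥((localPoints W ℚ_[2])[(2 : ℕ)])) ≠ w := fun h ↦ hw0 h.symm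
  have ne3 : (0 : ↥((localPoints W ℚ_[2])[(2 : ℕ)])) ≠ s := fun h ↦ hs0 (congrArg Subtype.val h).symm
  have ne4 : (0 : ↥((localPoints W ℚ_[2])[(2 : ℕ)])) ≠ q := fun h ↦ hQ0 (congrArg Subtype.val h).symm
  have ne5 : u ≠ s := fun h ↦ hsu (congrArg Subtype.val h).symm
  have ne6 : u ≠ q := fun h ↦ hQu (congrArg Subtype.val h).symm
  have ne7 : w ≠ s := fun h ↦ hsw (congrArg Subtype.val h).symm
  have ne8 : w ≠ q := fun h ↦ hQw (congrArg Subtype.val h).symm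
  have ne9 : s ≠ q := fun h ↦ hQs (congrArg Subtype.val h).symm
  have hcard5 : ({0, u, w, s, q} : Finset ↥((localPoints W ℚ_[2])[(2 : ℕ)])).card = 5 := by
    rw [Finset.card_insert_of_notMem, Finset.card_insert_of_notMem, Finset.card_insert_of_notMem,
      Finset.card_insert_of_notMem, Finset.card_singleton]
    · simpa only [Finset.mem_singleton] using ne9
    · simpa only [Finset.mem_insert, Finset.mem_singleton, not_or] using And.intro ne7 ne8
    · simpa only [Finset.mem_insert, Finset.mem_singleton, not_or] using And.intro huw (And.intro ne5 ne6)
    · simpa only [Finset.mem_insert, Finset.mem_singleton, not_or] using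
        And.intro ne1 (And.intro ne2 (And.intro ne3 ne4))
  have hle : ({0, u, w, s, q} : Finset ↥((localPoints W ℚ_[2])[(2 : ℕ)])).card ≤ 4 := by
    have h := Finset.card_le_univ ({0, u, w, s, q} : Finset ↥((localPoints W ℚ_[2])[(2 : ℕ)]))
    rwa [← Nat.card_eq_fintype_card, hcard] at h
  omega

omit [W.IsElliptic] in
/-- **The square root of `Δ` inside `ℚ₂(E[2])`.** If `x₁, x₂, x₃` are the `x`-coordinates of the three points of order
`2`, then `Δ_min = 16·((x₁−x₂)(x₁−x₃)(x₂−x₃))²` in `ℚ̄₂` (`discr(4x³+b₂x²+2b₄x+b₆) = 16Δ`, Mathlib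
`twoTorsionPolynomial_discr`, `Cubic.discr_eq_prod_three_roots`). [cite: SilvermanAEC2009, III.1 and III.2.3] -/
theorem minimalDiscriminantInt_eq_sixteen_mul_sq {x₁ x₂ x₃ : (AlgebraicClosure ℚ_[2])}
    (h₁ : (W.baseChange (AlgebraicClosure ℚ_[2])).twoTorsionPolynomial.toPoly.IsRoot x₁)
    (h₂ : (W.baseChange (AlgebraicClosure ℚ_[2])).twoTorsionPolynomial.toPoly.IsRoot x₂)
    (h₃ : (W.baseChange (AlgebraicClosure ℚ_[2])).twoTorsionPolynomial.toPoly.IsRoot x₃)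
    (h12 : x₁ ≠ x₂) (h13 : x₁ ≠ x₃) (h23 : x₂ ≠ x₃) :
    algebraMap ℚ_[2] (AlgebraicClosure ℚ_[2]) ((minimalDiscriminantInt W : ℤ) : ℚ_[2]) =
      16 * ((x₁ - x₂) * (x₁ - x₃) * (x₂ - x₃)) ^ 2 := by
  set C := (W.baseChange (AlgebraicClosure ℚ_[2])).twoTorsionPolynomial with hC
  have ha : C.a ≠ 0 := by rw [hC, WeierstrassCurve.twoTorsionPolynomial]; norm_num
  have hne : C.toPoly ≠ 0 := Cubic.ne_zero_of_a_ne_zero ha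
  -- the three roots exhaust the roots of the cubic
  have hroots : (Cubic.map (RingHom.id (AlgebraicClosure ℚ_[2])) C).roots = {x₁, x₂, x₃} := by
    rw [Cubic.map_roots, Polynomial.map_id]
    symm
    refine Multiset.eq_of_le_of_card_le ?_ ?_
    · refine (Multiset.le_iff_subset ?_).mpr ?_
      · simp [h12, h13, h23]
      · intro x hx
        simp only [Multiset.mem_cons, Multiset.mem_singleton, Multiset.insert_eq_cons] at hx
        rcases hx with rfl | rfl | rfl
        · exact (Polynomial.mem_roots hne).mpr h₁
        · exact (Polynomial.mem_roots hne).mpr h₂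
        · exact (Polynomial.mem_roots hne).mpr h₃
    · calc C.toPoly.roots.card ≤ C.toPoly.natDegree := Polynomial.card_roots' _
        _ = 3 := Cubic.natDegree_of_a_ne_zero ha
        _ = ({x₁, x₂, x₃} : Multiset (AlgebraicClosure ℚ_[2])).card := by simp
  have hdisc := Cubic.discr_eq_prod_three_roots (φ := RingHom.id (AlgebraicClosure ℚ_[2])) ha hroots
  rw [RingHom.id_apply, RingHom.id_apply, hC, WeierstrassCurve.twoTorsionPolynomial_discr] at hdisc
  have ha4 : (W.baseChange (AlgebraicClosure ℚ_[2])).twoTorsionPolynomial.a = 4 := rfl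
  rw [ha4] at hdisc
  -- `Δ(W ⊗ ℚ̄₂) = Δ_min` (globally minimal integral model)
  have hΔ : (W.baseChange (AlgebraicClosure ℚ_[2])).Δ = algebraMap ℚ_[2] (AlgebraicClosure ℚ_[2]) ((minimalDiscriminantInt W : ℤ) : ℚ_[2]) := by
    have h := congrArg WeierstrassCurve.Δ (map_integralModelInt W)
    rw [WeierstrassCurve.map_Δ] at h
    rw [WeierstrassCurve.baseChange, WeierstrassCurve.map_Δ, ← h, minimalDiscriminantInt]
    simp
  rw [← hΔ]
  have h16 : (16 : (AlgebraicClosure ℚ_[2])) ≠ 0 := by norm_num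
  apply mul_left_cancel₀ h16
  linear_combination hdisc

omit [W.IsElliptic] [W.IsGloballyMinimal] in
/-- An element of `ℚ̄₂` fixed by `Gal(ℚ̄₂/ℚ₂)` lies in `ℚ₂` (Galois correspondence; tree `mem_layer_iff_forall_smul_eq` at
layer `0`). [cite: NeukirchANT1999, Ch. IV §1] -/
theorem exists_algebraMap_eq_of_forall_smul_eq {d : (AlgebraicClosure ℚ_[2])} (hd : ∀ σ : absoluteGaloisGroup ℚ_[2], σ • d = d) :
    ∃ d₀ : ℚ_[2], algebraMap ℚ_[2] (AlgebraicClosure ℚ_[2]) d₀ = d := by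
  have hmem : d ∈ Additive.PadicCyclotomicTower.layer 2 0 :=
    (Additive.PadicCyclotomicTower.mem_layer_iff_forall_smul_eq d).mpr fun σ _ ↦ hd σ
  rw [Additive.PadicCyclotomicTower.layer_zero, IntermediateField.mem_bot] at hmem
  obtain ⟨d₀, hd₀⟩ := hmem
  exact ⟨d₀, hd₀⟩

omit [W.IsElliptic] in
/-- `Δ_min` is not `16` times a square in `ℚ₂`: `Δ_min ≡ 5 (mod 8)` at a good supersingular `2`
(`minimalDiscriminantInt_emod_eight_eq_five_of_goodSS_two`), whereas `16d₀² = (4d₀)²` with `4d₀ ∈ ℤ₂` is `≡ 0, 1, 4 (mod 8)`.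
[cite: Serre1973, Ch. II §3.3] -/
theorem minimalDiscriminantInt_ne_sixteen_mul_sq (hss : GoodSS W 2) (d₀ : ℚ_[2]) :
    ((minimalDiscriminantInt W : ℤ) : ℚ_[2]) ≠ 16 * d₀ ^ 2 := by
  intro h
  set u : ℚ_[2] := 4 * d₀ with hu
  have hu2 : u ^ 2 = ((minimalDiscriminantInt W : ℤ) : ℚ_[2]) := by rw [h, hu]; ring
  have hun : ‖u‖ ≤ 1 := by
    have h1 : ‖u‖ ^ 2 ≤ 1 := by
      rw [← norm_pow, hu2]; exact Padic.norm_int_le_one _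
    nlinarith [norm_nonneg u]
  set u' : ℤ_[2] := ⟨u, hun⟩ with hu'
  have hu'2 : u' ^ 2 = ((minimalDiscriminantInt W : ℤ) : ℤ_[2]) := by
    apply Subtype.ext
    push_cast
    exact hu2
  have h5 := Supersingular.minimalDiscriminantInt_emod_eight_eq_five_of_goodSS_two W hss
  have hz : (PadicInt.toZModPow 3 u') ^ 2 = (5 : ZMod (2 ^ 3)) := by
    rw [← map_pow, hu'2, map_intCast]
    have h8 : (((minimalDiscriminantInt W % (8 : ℕ) : ℤ)) : ZMod (2 ^ 3)) =
        ((minimalDiscriminantInt W : ℤ) : ZMod (2 ^ 3)) := ZMod.intCast_mod _ 8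
    rw [← h8]
    have : minimalDiscriminantInt W % (8 : ℕ) = 5 := h5
    rw [this]; rfl
  have hall : ∀ z : ZMod (2 ^ 3), z ^ 2 ≠ 5 := by decide
  exact hall _ hz

end Mixed


end Summit.BirchSwinnertonDyer.BirchSwinnertonDyer.Theorems.SignedTransportAtTwo

end
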